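import Literature.NumberTheory.Sieve.Maynard2016Lemma7PairBound
import Literature.NumberTheory.Sieve.Maynard2016Lemma7ShiftCutoff
import Literature.NumberTheory.Sieve.Maynard2016Lemma7LamShift
import Literature.NumberTheory.Sieve.Maynard2016I1Expand

/-!
# Maynard (2016), Lemma 7 — the engine bound for the translated (pattern) weights

J. Maynard, *Large gaps between primes*, Ann. of Math. 183 (2016), §6, proof of Lemma 7, the
paragraph before (6.33): restricting `q` to a residue class modulo a mid prime `p` multiplies the
main term by `≪_k 1/p`.  In the finite probability model (`Maynard2016Lemma7ProbIndep`,
`Maynard2016Lemma7LamShift`) the class sum is controlled by the quadratic forms `Q(W_{S,T}, W_{S,T})`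
of the smooth pattern weights, i.e. (by `ofReal_Qform_smoothWt_eq`) by weighted coupled `lcm`-sums
with the TRANSLATED cutoffs `F̃_{ℓ,j}(· + σ_ℓ)`, `G̃(· + τ_ℓ)` (`σ_ℓ = [ℓ ∈ S] log p/log x`,
`τ_ℓ = [ℓ ∈ T] log p/log y`; `F̃ = χ_δ F`, `G̃ = χ_δ G` the left-cut data, equal to `F, G` on `[0,∞)`).

Here we bound these sums UNIFORMLY in the pattern and in the prime `p ≤ y^{1−δ}`:

* `chiD`, `cutLeftD` — the left cut `χ_δ` (`= 1` on `[0,∞)`, `= 0` on `(−∞,−δ]`) for a parameter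
  `0 < δ`, and the cut data `cutF δ F`, `cutLeftD δ G`;
* `norm_pairConst7_le`, `integral_PsiMaj_mono` — `|c[F,F',G,G']| ≤ I[F,F'] I[G,G']` and
  monotonicity of `I = ∫ Ψ` under domination of the one-slot majorants;
* `eventually_norm_logpow_mul_patternSum_le` — for sieve data, `0 < ε ≤ 1/2`, `0 < δ < 1`:
  there is `C` (depending only on the data, `δ`) with, eventually in `x`, for all
  `1 ≤ m ≤ x < p₀ ≤ x²`, all primes `p` with `log p ≤ (1−δ) log y`, all patterns `S, T` and all
  `j, j'`: `‖(log x)^{k−1}(log y)^{k−1} S^φ[translated cutoffs]‖ ≤ C · 𝔖⁷` — by the uniform engine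
  bound `eventually_norm_logpow_mul_coupledLcmSumW7_sub_le_of_psiMaj_le` (translation by
  `u ∈ [0, 1−δ]` of a cutoff vanishing below `−δ` is a phase on the Fourier side,
  `Maynard2016Lemma7ShiftCutoff`).

## References

* J. Maynard, *Large gaps between primes*, Ann. of Math. (2) 183 (2016), 915–933; arXiv:1408.5110,
  §6, proof of Lemma 7 (before (6.33)), displays (6.8)–(6.19). [Maynard2016LargeGaps]
* D. H. J. Polymath, *Variants of the Selberg sieve, and bounded intervals containing many primes*,
  Res. Math. Sci. 1 (2014), Art. 12; arXiv:1407.4897, proof of Lemma 4.1. [Polymath8b2014]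
-/

noncomputable section

open Filter Finset Real MeasureTheory
open scoped BigOperators Topology ContDiff

namespace Literature.NumberTheory.Sieve

/-! ### The left cut with a parameter -/

/-- `χ_δ(t) = smoothTransition (t/δ + 1)`: smooth, `= 1` on `[0, ∞)`, `= 0` on `(−∞, −δ]` (`δ > 0`).
[cite: Maynard2016LargeGaps, Lemma 7 (proof, before (6.33))] -/
def chiD (δ t : ℝ) : ℝ := Real.smoothTransition (t / δ + 1)

/-- `χ_δ = 1` on `[0, ∞)`. [cite: Maynard2016LargeGaps, Lemma 7 (proof, before (6.33))] -/
theorem chiD_eq_one {δ : ℝ} (hδ : 0 < δ) {t : ℝ} (ht : 0 ≤ t) : chiD δ t = 1 :=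
  Real.smoothTransition.one_of_one_le (by have := div_nonneg ht hδ.le; linarith)

/-- `χ_δ = 0` on `(−∞, −δ]`. [cite: Maynard2016LargeGaps, Lemma 7 (proof, before (6.33))] -/
theorem chiD_eq_zero {δ : ℝ} (hδ : 0 < δ) {t : ℝ} (ht : t ≤ -δ) : chiD δ t = 0 :=
  Real.smoothTransition.zero_of_nonpos (by
    have : t / δ ≤ -1 := by rw [div_le_iff₀ hδ]; linarith
    linarith)

/-- `0 ≤ χ_δ`. [cite: Maynard2016LargeGaps, Lemma 7 (proof, before (6.33))] -/
theorem chiD_nonneg (δ t : ℝ) : 0 ≤ chiD δ t := Real.smoothTransition.nonneg _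

/-- `χ_δ` is smooth. [cite: Maynard2016LargeGaps, Lemma 7 (proof, before (6.33))] -/
theorem contDiff_chiD (δ : ℝ) : ContDiff ℝ ∞ (chiD δ) :=
  Real.smoothTransition.contDiff.comp ((contDiff_id.div_const δ).add contDiff_const)

/-- The left cut `(χ_δ F)(t) = χ_δ(t) F(t)`. [cite: Maynard2016LargeGaps, Lemma 7 (proof, before (6.33))] -/
def cutLeftD (δ : ℝ) (F : ℝ → ℝ) (t : ℝ) : ℝ := chiD δ t * F t

/-- `χ_δ F = F` on `[0, ∞)`. [cite: Maynard2016LargeGaps, Lemma 7 (proof, before (6.33))] -/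
theorem cutLeftD_eq {δ : ℝ} (hδ : 0 < δ) (F : ℝ → ℝ) {t : ℝ} (ht : 0 ≤ t) :
    cutLeftD δ F t = F t := by
  rw [cutLeftD, chiD_eq_one hδ ht, one_mul]

/-- `χ_δ F` vanishes on `(−∞, −δ)`. [cite: Maynard2016LargeGaps, Lemma 7 (proof, before (6.33))] -/
theorem cutLeftD_eq_zero {δ : ℝ} (hδ : 0 < δ) (F : ℝ → ℝ) {t : ℝ} (ht : t < -δ) :
    cutLeftD δ F t = 0 := by
  rw [cutLeftD, chiD_eq_zero hδ ht.le, zero_mul]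

/-- `χ_δ F ≥ 0` if `F ≥ 0`. [cite: Maynard2016LargeGaps, Lemma 7 (proof, before (6.33))] -/
theorem cutLeftD_nonneg (δ : ℝ) {F : ℝ → ℝ} (hF : ∀ t, 0 ≤ F t) (t : ℝ) : 0 ≤ cutLeftD δ F t :=
  mul_nonneg (chiD_nonneg δ t) (hF t)

/-- `χ_δ F` is a sieve cutoff with the same support bound. [cite: Maynard2016LargeGaps, Lemma 7 (proof, before (6.33))] -/
theorem IsSieveCutoff.cutLeftD (δ : ℝ) {F : ℝ → ℝ} {s : ℝ} (h : IsSieveCutoff F s) :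
    IsSieveCutoff (cutLeftD δ F) s where
  contDiff := (contDiff_chiD δ).mul h.contDiff
  nonneg := h.nonneg
  eq_zero := fun t ht => by rw [Literature.NumberTheory.Sieve.cutLeftD, h.eq_zero t ht, mul_zero]

/-- **The translated left-cut cutoff is dominated by the left-cut cutoff**: for `0 ≤ u ≤ 1 − δ`,
`|f_{(χ_δ F)(·+u)}(ξ)| ≤ |f_{χ_δ F}(ξ)|`. [cite: Maynard2016LargeGaps, Lemma 7 (proof, before (6.33))] -/
theorem IsSieveCutoff.norm_fourierWeight_cutLeftD_translate_le {δ : ℝ} (hδ : 0 < δ) {F : ℝ → ℝ}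
    {s u : ℝ} (h : IsSieveCutoff F s) (hu : 0 ≤ u) (hu1 : u ≤ 1 - δ) (ξ : ℝ) :
    ‖((h.cutLeftD δ).translate hu).fourierWeight ξ‖ ≤ ‖(h.cutLeftD δ).fourierWeight ξ‖ :=
  (h.cutLeftD δ).norm_fourierWeight_translate_le (δ := δ) (fun _ ht => cutLeftD_eq_zero hδ F ht)
    hu hu1 ξ

namespace Maynard2016

open LcmEuler

/-! ### The pair constant is bounded by the majorant integrals -/

section Const

variable {ι κ : Type*} [Fintype ι] [Fintype κ]
  {F F' : ι → ℝ → ℝ} {G G' : κ → ℝ → ℝ} {sF sF' : ι → ℝ} {sG sG' : κ → ℝ}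
  (hF : ∀ l, IsSieveCutoff (F l) (sF l)) (hF' : ∀ l, IsSieveCutoff (F' l) (sF' l))
  (hG : ∀ l, IsSieveCutoff (G l) (sG l)) (hG' : ∀ l, IsSieveCutoff (G' l) (sG' l))

include hF hF' hG hG' in
/-- **`|c[F,F',G,G']| ≤ I[F,F'] · I[G,G']`** with `I[F,F'] = ∫ Ψ[F,F']`: the pair constant (6.19) is
the integral of `Φ · M` (`integral_coupledPhi_mul_pairModel7`) and `|Φ M| ≤ Ψ ⊗ Ψ`.
[cite: Maynard2016LargeGaps, Lemma 7 (proof, displays (6.17)–(6.19))] -/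
theorem norm_pairConst7_le :
    ‖pairConst7 F F' G G'‖ ≤ (∫ q, PsiMaj hF hF' q) * ∫ q, PsiMaj hG hG' q := by
  rw [← integral_coupledPhi_mul_pairModel7 hF hF' hG hG']
  refine (norm_integral_le_integral_norm _).trans ?_
  have h1 : Integrable (fun p : (ι → ℝ × ℝ) × (κ → ℝ × ℝ) =>
      PsiMaj hF hF' p.1 * PsiMaj hG hG' p.2) :=
    (integrable_PsiMaj hF hF').mul_prod (integrable_PsiMaj hG hG')
  have h2 : ∫ p : (ι → ℝ × ℝ) × (κ → ℝ × ℝ), PsiMaj hF hF' p.1 * PsiMaj hG hG' p.2 =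
      (∫ q, PsiMaj hF hF' q) * ∫ q, PsiMaj hG hG' q := by
    rw [Measure.volume_eq_prod]
    exact integral_prod_mul (fun q => PsiMaj hF hF' q) (fun q => PsiMaj hG hG' q)
  rw [← h2]
  refine integral_mono_of_nonneg (ae_of_all _ fun p => norm_nonneg _) h1 (ae_of_all _ fun p => ?_)
  dsimp only
  rw [norm_mul, coupledPhi, norm_mul, norm_mul,
    show ‖fourierPhi hF hF' p.1‖ * ‖fourierPhi hG hG' p.2‖ * (‖pairModel p.1‖ * ‖pairModel p.2‖) =
      (‖fourierPhi hF hF' p.1‖ * ‖pairModel p.1‖) * (‖fourierPhi hG hG' p.2‖ * ‖pairModel p.2‖)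
      by ring]
  exact mul_le_mul (norm_fourierPhi_mul_pairModel_le hF hF' p.1)
    (norm_fourierPhi_mul_pairModel_le hG hG' p.2) (by positivity) (PsiMaj_nonneg hF hF' _)

end Const

section Mono

variable {ι : Type*} [Fintype ι]
  {F F' F₂ F₂' : ι → ℝ → ℝ} {sF sF' sF₂ sF₂' : ι → ℝ}
  (hF : ∀ l, IsSieveCutoff (F l) (sF l)) (hF' : ∀ l, IsSieveCutoff (F' l) (sF' l))
  (hF₂ : ∀ l, IsSieveCutoff (F₂ l) (sF₂ l)) (hF₂' : ∀ l, IsSieveCutoff (F₂' l) (sF₂' l))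

include hF hF' hF₂ hF₂' in
/-- `I[F₂,F₂'] ≤ I[F,F']` when the one-slot majorants are dominated, `ψ_l[F₂,F₂'] ≤ ψ_l[F,F']`.
[cite: Maynard2016LargeGaps, Lemma 7 (proof, displays (6.17)–(6.19))] -/
theorem integral_PsiMaj_mono (hdom : ∀ l q, psiMaj hF₂ hF₂' l q ≤ psiMaj hF hF' l q) :
    ∫ q, PsiMaj hF₂ hF₂' q ≤ ∫ q, PsiMaj hF hF' q :=
  integral_mono (integrable_PsiMaj hF₂ hF₂') (integrable_PsiMaj hF hF') fun q =>
    Finset.prod_le_prod (fun l _ => psiMaj_nonneg hF₂ hF₂' l (q l)) fun l _ => hdom l (q l)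

end Mono

/-! ### The engine bound for the translated cutoffs, uniformly in the pattern -/

variable {k J : ℕ}

/-- The left-cut `F`-data `(χ_δ F_{ℓ,j})`. [cite: Maynard2016LargeGaps, Lemma 7 (proof, before (6.33))] -/
def cutF (δ : ℝ) (Fd : Fin k → Fin J → ℝ → ℝ) : Fin k → Fin J → ℝ → ℝ :=
  fun ℓ j => cutLeftD δ (Fd ℓ j)

/-- The left-cut data agree with the data on `[0, ∞)` (`F`-side). [cite: Maynard2016LargeGaps, Lemma 7 (proof, before (6.33))] -/
theorem cutF_eq {δ : ℝ} (hδ : 0 < δ) (Fd : Fin k → Fin J → ℝ → ℝ) (ℓ : Fin k) (j : Fin J) {t : ℝ}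
    (ht : 0 ≤ t) : cutF δ Fd ℓ j t = Fd ℓ j t :=
  cutLeftD_eq hδ _ ht

/-- The left-cut data satisfy the support hypotheses. [cite: Maynard2016LargeGaps, §5 displays (5.3)–(5.4)] -/
theorem IsSieveData.suppG_cut {c : Fin J → ℝ} {Fd : Fin k → Fin J → ℝ → ℝ} {G : ℝ → ℝ}
    (hD : IsSieveData k J c Fd G) {δ : ℝ} (hδ : 0 < δ) :
    SuppG k J (cutF δ Fd) (fun _ => cutLeftD δ G) :=
  hD.suppG.congr_nonneg (fun ℓ j _ ht => cutF_eq hδ Fd ℓ j ht) (fun _ _ ht => cutLeftD_eq hδ G ht)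

/-- `σ_ℓ ≤ 1 − δ` when `log p ≤ (1−δ) log y` and `y ≤ x`. [cite: Maynard2016LargeGaps, Lemma 7 (proof, before (6.33))] -/
theorem sigmaP_le {p x : ℕ} {ε δ : ℝ} (hlogy : 0 < Real.log (y ε x))
    (hyx : Real.log (y ε x) ≤ Real.log x) (hp : Real.log p ≤ (1 - δ) * Real.log (y ε x))
    (hδ : δ ≤ 1) (S : Finset (Fin k)) (ℓ : Fin k) : sigmaP p x S ℓ ≤ 1 - δ := by
  unfold sigmaP
  split_ifs
  · have hlogx : 0 < Real.log x := lt_of_lt_of_le hlogy hyx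
    rw [div_le_iff₀ hlogx]
    have h1 : (1 - δ) * Real.log (y ε x) ≤ (1 - δ) * Real.log x :=
      mul_le_mul_of_nonneg_left hyx (by linarith)
    linarith
  · linarith

/-- `τ_ℓ ≤ 1 − δ` when `log p ≤ (1−δ) log y`. [cite: Maynard2016LargeGaps, Lemma 7 (proof, before (6.33))] -/
theorem tauP_le {p x : ℕ} {ε δ : ℝ} (hlogy : 0 < Real.log (y ε x))
    (hp : Real.log p ≤ (1 - δ) * Real.log (y ε x)) (hδ : δ ≤ 1) (T : Finset (Fin k)) (ℓ : Fin k) :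
    tauP p ε x T ℓ ≤ 1 - δ := by
  unfold tauP
  split_ifs
  · rwa [div_le_iff₀ hlogy]
  · linarith

/-- `‖A − s B‖ ≤ 1·s`, `‖B‖ ≤ I`, `s ≥ 0` give `‖A‖ ≤ (I + 1) s`. [folklore] -/
private theorem norm_le_of_norm_sub_le_aux (A B : ℂ) {I s : ℝ} (h : ‖A - (s : ℂ) * B‖ ≤ 1 * s)
    (hB : ‖B‖ ≤ I) (hs : 0 ≤ s) : ‖A‖ ≤ (I + 1) * s := by
  have h1 : ‖A‖ ≤ ‖(s : ℂ) * B‖ + ‖A - (s : ℂ) * B‖ := norm_le_insert' _ _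
  rw [norm_mul, Complex.norm_real, Real.norm_of_nonneg hs] at h1
  have h2 : s * ‖B‖ ≤ s * I := mul_le_mul_of_nonneg_left hB hs
  nlinarith

set_option maxHeartbeats 400000 in
/-- **The engine bound for the translated cutoffs, uniformly in the pattern and the prime**:
for sieve data, `0 < ε ≤ 1/2`, `0 < δ ≤ 1` there is `C ≥ 0` such that, eventually in `x`, for all
`1 ≤ m ≤ x < p₀ ≤ x²`, all `p` with `log p ≤ (1−δ) log y`, all patterns `S, T ⊆ {1,…,k}` and all
`j, j'`,
`‖(log x)^{k−1} (log y)^{k−1} · S^φ_{i}[F̃_{·,j}(·+σ), F̃_{·,j'}(·+σ), G̃(·+τ), G̃(·+τ)]‖ ≤ C · 𝔖⁷`,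
where `F̃ = χ_δ F`, `G̃ = χ_δ G`, `σ = σ^{(p,S)}`, `τ = τ^{(p,T)}` and
`𝔖⁷ = singSmall (k−1) x · nuProd7 k x m p₀ i`.
[cite: Maynard2016LargeGaps, Lemma 7 (proof, before (6.33); displays (6.8)–(6.19))] -/
theorem eventually_norm_logpow_mul_patternSum_le {c : Fin J → ℝ} {Fd : Fin k → Fin J → ℝ → ℝ}
    {G : ℝ → ℝ} (hD : IsSieveData k J c Fd G) (i : Fin k) {ε : ℝ} (hε0 : 0 < ε) (hε : ε ≤ 1 / 2)
    {δ : ℝ} (hδ0 : 0 < δ) (hδ1 : δ ≤ 1) :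
    ∃ C : ℝ, 0 ≤ C ∧ ∀ᶠ x : ℕ in atTop, ∀ m p₀ : ℕ, 1 ≤ m → m ≤ x → x < p₀ →
      (p₀ : ℝ) ≤ (x : ℝ) ^ 2 → ∀ p : ℕ, Real.log p ≤ (1 - δ) * Real.log (y ε x) →
      ∀ S T : Finset (Fin k), ∀ j j' : Fin J,
        ‖(Real.log x : ℂ) ^ (k - 1) * (Real.log (y ε x) : ℂ) ^ (k - 1) *
            coupledLcmSumW phiInv (Pw x) m (restrictPairs i i (couplingSet7 k x m p₀ i))
              (fun l : {l : Fin k // l ≠ i} => trF (sigmaP p x S) (cutF δ Fd) l.1 j)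
              (fun l => trF (sigmaP p x S) (cutF δ Fd) l.1 j')
              (fun l => trG (tauP p ε x T) (fun _ => cutLeftD δ G) l.1)
              (fun l => trG (tauP p ε x T) (fun _ => cutLeftD δ G) l.1) (x : ℝ) (y ε x) x‖ ≤
          C * (singSmall (k - 1) x * nuProd7 k x m p₀ i) := by
  -- reference cutoffs (the left-cut data) on the free slots
  have hFr : ∀ j (l : {l : Fin k // l ≠ i}), IsSieveCutoff (cutF δ Fd l.1 j) (1 / 10) :=
    fun j l => (hD.isSieveCutoff_Fd l.1 j).cutLeftD δ
  have hGr : ∀ l : {l : Fin k // l ≠ i}, IsSieveCutoff (cutLeftD δ G) 1 :=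
    fun _ => hD.isSieveCutoff_G.cutLeftD δ
  -- the constant
  have hI₂0 : 0 ≤ ∫ q, PsiMaj hGr hGr q := integral_nonneg (PsiMaj_nonneg hGr hGr)
  have hI₁0 : ∀ j j', 0 ≤ ∫ q, PsiMaj (hFr j) (hFr j') q := fun j j' =>
    integral_nonneg (PsiMaj_nonneg (hFr j) (hFr j'))
  have hIJ0 : ∀ j j', (0 : ℝ) ≤ (∫ q, PsiMaj (hFr j) (hFr j') q) * (∫ q, PsiMaj hGr hGr q) + 1 :=
    fun j j' => add_nonneg (mul_nonneg (hI₁0 j j') hI₂0) zero_le_one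
  refine ⟨∑ j, ∑ j', ((∫ q, PsiMaj (hFr j) (hFr j') q) * (∫ q, PsiMaj hGr hGr q) + 1),
    Finset.sum_nonneg fun j _ => Finset.sum_nonneg fun j' _ => hIJ0 j j', ?_⟩
  have hE := Filter.eventually_all.2 fun jj : Fin J × Fin J =>
    eventually_norm_logpow_mul_coupledLcmSumW7_sub_le_of_psiMaj_le (hFr jj.1) (hFr jj.2) hGr hGr
      hε0 hε one_pos
  filter_upwards [hE, eventually_y_lt_half hε0 (by linarith), eventually_iteratedLogs,
    eventually_gt_atTop 1] with x hx hyx hlogs hx1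
  obtain ⟨hL, hL₂, hL₃, -, hL₂L, -, -⟩ := hlogs
  intro m p₀ hm1 hm hxp hp2 p hp S T j j'
  have hx0 : (0 : ℝ) < x := Nat.cast_pos.2 (lt_trans Nat.zero_lt_one hx1)
  have hlogy : 0 < Real.log (y ε x) := log_y_pos hε (by linarith) (by linarith) hL₃
  have hy0 : 0 < y ε x := by unfold y; exact Real.exp_pos _
  have hylex : Real.log (y ε x) ≤ Real.log x :=
    Real.log_le_log hy0 (by linarith)
  have hlogx : 0 < Real.log x := lt_of_lt_of_le hlogy hylex
  -- the shifts lie in `[0, 1 − δ]`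
  have hσ0 : ∀ l : {l : Fin k // l ≠ i}, 0 ≤ sigmaP p x S l.1 := fun l =>
    sigmaP_nonneg p hlogx S l.1
  have hτ0 : ∀ l : {l : Fin k // l ≠ i}, 0 ≤ tauP p ε x T l.1 := fun l =>
    tauP_nonneg p hlogy T l.1
  have hσ1 : ∀ l : {l : Fin k // l ≠ i}, sigmaP p x S l.1 ≤ 1 - δ := fun l =>
    sigmaP_le hlogy hylex hp hδ1 S l.1
  have hτ1 : ∀ l : {l : Fin k // l ≠ i}, tauP p ε x T l.1 ≤ 1 - δ := fun l =>
    tauP_le hlogy hp hδ1 T l.1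
  -- the translated cutoffs and their domination
  have hF₂ : ∀ l : {l : Fin k // l ≠ i},
      IsSieveCutoff (trF (sigmaP p x S) (cutF δ Fd) l.1 j) (1 / 10) := fun l =>
    (hFr j l).translate (hσ0 l)
  have hF₂' : ∀ l : {l : Fin k // l ≠ i},
      IsSieveCutoff (trF (sigmaP p x S) (cutF δ Fd) l.1 j') (1 / 10) := fun l =>
    (hFr j' l).translate (hσ0 l)
  have hG₂ : ∀ l : {l : Fin k // l ≠ i},
      IsSieveCutoff (trG (tauP p ε x T) (fun _ => cutLeftD δ G) l.1) 1 := fun l =>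
    (hGr l).translate (hτ0 l)
  have hvanF : ∀ (j : Fin J) (l : {l : Fin k // l ≠ i}) (t : ℝ), t < -δ → cutF δ Fd l.1 j t = 0 :=
    fun j l t ht => cutLeftD_eq_zero hδ0 _ ht
  have hvanG : ∀ t : ℝ, t < -δ → cutLeftD δ G t = 0 := fun t ht => cutLeftD_eq_zero hδ0 _ ht
  have hdomF : ∀ l q, psiMaj hF₂ hF₂' l q ≤ psiMaj (hFr j) (hFr j') l q :=
    psiMaj_mono (hFr j) (hFr j') hF₂ hF₂'
      (fun l ξ => (hFr j l).norm_fourierWeight_translate_le (hvanF j l) (hσ0 l) (hσ1 l) ξ)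
      (fun l ξ => (hFr j' l).norm_fourierWeight_translate_le (hvanF j' l) (hσ0 l) (hσ1 l) ξ)
  have hdomG : ∀ l q, psiMaj hG₂ hG₂ l q ≤ psiMaj hGr hGr l q :=
    psiMaj_mono hGr hGr hG₂ hG₂
      (fun l ξ => (hGr l).norm_fourierWeight_translate_le hvanG (hτ0 l) (hτ1 l) ξ)
      (fun l ξ => (hGr l).norm_fourierWeight_translate_le hvanG (hτ0 l) (hτ1 l) ξ)
  have hmain := hx (j, j') hF₂ hF₂' hG₂ hG₂ (fun _ => ⟨by norm_num, by norm_num⟩)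
    (fun _ => ⟨le_rfl, le_rfl⟩) hdomF hdomG m p₀ hm1 hm hxp hp2
  -- the pair constant of the translated cutoffs
  have hc : ‖pairConst7 (fun l : {l : Fin k // l ≠ i} => trF (sigmaP p x S) (cutF δ Fd) l.1 j)
      (fun l : {l : Fin k // l ≠ i} => trF (sigmaP p x S) (cutF δ Fd) l.1 j')
      (fun l : {l : Fin k // l ≠ i} => trG (tauP p ε x T) (fun _ => cutLeftD δ G) l.1)
      (fun l : {l : Fin k // l ≠ i} => trG (tauP p ε x T) (fun _ => cutLeftD δ G) l.1)‖ ≤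
      (∫ q, PsiMaj (hFr j) (hFr j') q) * ∫ q, PsiMaj hGr hGr q :=
    (norm_pairConst7_le hF₂ hF₂' hG₂ hG₂).trans (mul_le_mul
      (integral_PsiMaj_mono (hFr j) (hFr j') hF₂ hF₂' hdomF)
      (integral_PsiMaj_mono hGr hGr hG₂ hG₂ hdomG) (integral_nonneg (PsiMaj_nonneg hG₂ hG₂))
      (hI₁0 j j'))
  -- conclusion: `‖A‖ ≤ ‖𝔖 c‖ + ‖A − 𝔖 c‖ ≤ (I₁ I₂ + 1) 𝔖 ≤ C 𝔖`
  have hS0 : 0 ≤ singSmall (k - 1) x * nuProd7 k x m p₀ i :=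
    (mul_pos (singSmall_pos _ _) (nuProd7_pos k x m p₀ i)).le
  have hle : (∫ q, PsiMaj (hFr j) (hFr j') q) * (∫ q, PsiMaj hGr hGr q) + 1 ≤
      ∑ j, ∑ j', ((∫ q, PsiMaj (hFr j) (hFr j') q) * (∫ q, PsiMaj hGr hGr q) + 1) := by
    have h1 : (∫ q, PsiMaj (hFr j) (hFr j') q) * (∫ q, PsiMaj hGr hGr q) + 1 ≤
        ∑ j'', ((∫ q, PsiMaj (hFr j) (hFr j'') q) * (∫ q, PsiMaj hGr hGr q) + 1) :=
      Finset.single_le_sum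
        (f := fun j'' => (∫ q, PsiMaj (hFr j) (hFr j'') q) * (∫ q, PsiMaj hGr hGr q) + 1)
        (fun j'' _ => hIJ0 j j'') (Finset.mem_univ j')
    exact h1.trans (Finset.single_le_sum
      (f := fun j => ∑ j'', ((∫ q, PsiMaj (hFr j) (hFr j'') q) * (∫ q, PsiMaj hGr hGr q) + 1))
      (fun j _ => Finset.sum_nonneg fun j'' _ => hIJ0 j j'') (Finset.mem_univ j))
  exact (norm_le_of_norm_sub_le_aux _ _ hmain hc hS0).trans (mul_le_mul_of_nonneg_right hle hS0)

end Maynard2016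

end Literature.NumberTheory.Sieve

end
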